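import Literature.AlgebraicGeometry.GroupSchemes.CartierDualBaseChange
import Literature.AlgebraicGeometry.GroupSchemes.AffineGroupSchemeBaseChangeNatural
import Literature.AlgebraicGeometry.GroupSchemes.CartierDualAnnihilatorRank
import HarnessLib

/-!
# The base-change isomorphism `(G^D)_{R′} ≅ (G_{R′})^D` of the Cartier dual, PINNED and NATURAL in `G`

Layer `Literature/AlgebraicGeometry/GroupSchemes`, namespace `Literature.AlgebraicGeometry.GroupSchemes.AffineGroupScheme` (continues ★
`CartierDualBaseChange` p845581 — the `∃`-form `exists_iso_cartierDual_baseChange`, `specOverIsoOfBialgEquiv`, `tensorAlgCartierDualBialgEquiv` —, ★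
`CartierDualAlgBaseChange` p845529 — `dualAlgBaseChangeEquiv`, `exists_bialgEquiv_tensor_dualAlg` (pinned by its formula) —, ★
`AffineGroupSchemeBaseChangeNatural` p846047 — `Γ(G_{R′}) ≅ R′ ⊗ Γ(G)` natural in `G` — and ★ `CartierDualAnnihilatorRank` p845797 §3 —
`e_G ∘ Γ(j^D) = (Γ(j))^* ∘ e_H`, `coord_id_cartierDual`).  Three `def`s (`tensorDualAlgEquiv` — a CHOICE of the bialgebra equivalence of ★
`exists_bialgEquiv_tensor_dualAlg`, unique by its pinning formula —, `algCartierDualBaseChangeEquiv`, `cartierDualBaseChangeIso`) + theorems; no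
instance, no notation, no named fact, no `sorry`.  Cell `hodgecm-mathlib` (D-0151), programme P6 «MOD», organ (N2a-ii) of B-p04 (g37) — the input of
the base change of `H^⊥` ((N2b); A-p06 (g30) ★ `CartierDualAnnihilatorOfDuality`: «base change of `C^⊥` … to be assembled»).  Count-neutral
Mathlib-side capital: HC_CM is proved only modulo the printed citations until rung 0 closes; nothing here bears on it.

THE PRINT ([Tate1997FiniteFlatGroupSchemes] §(3.8) p. 145: «for an `R`-algebra `B`, `(A_B)′ = A′_B`», functorially in `A`).  For finite free
commutative affine group objects `H`, `G` of `SchemeOver R`, a commutative `R`-algebra `R′`, `X_{R′} := (Over.pullback (Spec R′ → Spec R)).obj X`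
(Mathlib's transported group object) and a homomorphism `j : H ⟶ G`:

* §1 **`tensorDualAlgEquiv R′ G : R′ ⊗_R Γ(G)^* ≃ₐc[R′] Γ(G_{R′})^*`** (`Ψ_G`), pinned by `dualAlgBaseChangeEquiv (Ψ (r ⊗ ν)) = r • ν_{R′}`
  (`tensorDualAlgEquiv_tmul_apply : (Ψ (r ⊗ ν))(y) = r · ν_{R′}(e_G y)`), and its NATURALITY **`transpose_pullback_map_comp_tensorDualAlgEquiv :
  (Γ(j_{R′}))^* ∘ Ψ_H = Ψ_G ∘ (R′ ⊗ (Γ(j))^*)`** (`dualBaseChange_transpose_apply`, ★ `algBaseChangeEquiv_comap_pullback_map`);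
* §2 **`algCartierDualBaseChangeEquiv R′ G : Γ((G^D)_{R′}) ≃ₐc[R′] Γ(G_{R′})^*`** (`Φ_G := Ψ_G ∘ (R′ ⊗ e_G) ∘ (Γ((G^D)_{R′}) ≅ R′ ⊗ Γ(G^D))`), its
  naturality `transpose_pullback_map_comp_algCartierDualBaseChangeEquiv : (Γ(j_{R′}))^* ∘ Φ_H = Φ_G ∘ Γ((j^D)_{R′})`, and the PINNED isomorphism of
  group schemes **`cartierDualBaseChangeIso R′ G : (G^D)_{R′} ≅ (G_{R′})^D`** (`isMonHom_cartierDualBaseChangeIso_hom`, `coord_cartierDualBaseChangeIso_hom :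
  coord φ_G.hom = Φ_G⁻¹`);
* §3 HEAD **`pullback_map_cartierDualMap_comp_cartierDualBaseChangeIso_hom : (j^D)_{R′} ≫ φ_H.hom = φ_G.hom ≫ (j_{R′})^D`** — THE BASE-CHANGE
  ISOMORPHISM OF THE CARTIER DUAL IS NATURAL IN `G`.

## References
* [Tate1997FiniteFlatGroupSchemes] J. Tate, *Finite flat group schemes*, in: Modular Forms and Fermat's Last Theorem (1997), §(3.8) p. 145.
* [GortzWedhorn2023] U. Görtz, T. Wedhorn, *Algebraic Geometry II* (2023), §(27.2) (pp. 606–607).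
-/

set_option autoImplicit false

-- Mathlib's `Over`/`Scheme` APIs are stated across semireducible wrappers (as in the ★ `GroupSchemes/*` files).
set_option backward.isDefEq.respectTransparency false

universe u

open CategoryTheory CategoryTheory.Limits AlgebraicGeometry MonoidalCategory CartesianMonoidalCategory TensorProduct WithConv

noncomputable section

namespace Literature.AlgebraicGeometry.GroupSchemes

namespace AffineGroupScheme

open scoped MonObj CategoryTheory.Obj

open Literature.AlgebraicGeometry.Motives Literature.NumberTheory.DiophantineGeometry Literature.RingTheory.HopfAlgebra

variable {R : Type u} [CommRing R] (R' : Type u) [CommRing R'] [Algebra R R']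

/-! ## §1 The pinned bialgebra equivalence `Ψ_G : R′ ⊗ Γ(G)^* ≃ Γ(G_{R′})^*` and its naturality -/

section Psi

variable (G : SchemeOver R) [GrpObj G] [IsCommMonObj G] [IsAffine G.left] [Module.Free R (Alg G)] [Module.Finite R (Alg G)]
  [IsAffine ((Over.pullback (Spec.map (CommRingCat.ofHom (algebraMap R R')))).obj G).left]
  [IsCommMonObj ((Over.pullback (Spec.map (CommRingCat.ofHom (algebraMap R R')))).obj G)]
  [Module.Free R' (Alg ((Over.pullback (Spec.map (CommRingCat.ofHom (algebraMap R R')))).obj G))]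
  [Module.Finite R' (Alg ((Over.pullback (Spec.map (CommRingCat.ofHom (algebraMap R R')))).obj G))]

/-- **`Ψ_G : R′ ⊗_R Γ(G)^* ≃ₐc[R′] Γ(G_{R′})^*`** — a CHOICE of the bialgebra equivalence of ★ `exists_bialgEquiv_tensor_dualAlg` (unique: it is pinned
on pure tensors by `tensorDualAlgEquiv_tmul_apply`). [cite: Tate1997FiniteFlatGroupSchemes, §(3.8) p. 145] -/
def tensorDualAlgEquiv :
    R' ⊗[R] DualAlg G ≃ₐc[R'] DualAlg ((Over.pullback (Spec.map (CommRingCat.ofHom (algebraMap R R')))).obj G) :=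
  (exists_bialgEquiv_tensor_dualAlg R' G).choose

/-- The pinning formula: `dualAlgBaseChangeEquiv (Ψ (r ⊗ ν)) = r • ν_{R′}` (`ν_{R′} :=` ★ `Tannakian.dualBaseChange R′ ν`).
[cite: Tate1997FiniteFlatGroupSchemes, §(3.8) p. 145] -/
theorem dualAlgBaseChangeEquiv_tensorDualAlgEquiv_tmul (r : R') (ν : DualAlg G) :
    letI := FiniteDual.bialgebra R' (R' ⊗[R] Alg G)
    dualAlgBaseChangeEquiv R' G (tensorDualAlgEquiv R' G (r ⊗ₜ ν)) =
      r • Tannakian.dualBaseChange (R := R) (A := Alg G) R' (show WithConv (Module.Dual R (Alg G)) from ν) :=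
  (exists_bialgEquiv_tensor_dualAlg R' G).choose_spec r ν

/-- **`(Ψ (r ⊗ ν))(y) = r · ν_{R′}(e_G y)`** for `y ∈ Γ(G_{R′})`, `e_G :=` ★ `algBaseChangeEquiv R′ G : Γ(G_{R′}) ≃ R′ ⊗ Γ(G)`.
[cite: Tate1997FiniteFlatGroupSchemes, §(3.8) p. 145] -/
theorem tensorDualAlgEquiv_tmul_apply (r : R') (ν : DualAlg G) (y : Alg ((Over.pullback (Spec.map (CommRingCat.ofHom (algebraMap R R')))).obj G)) :
    WithConv.ofConv (tensorDualAlgEquiv R' G (r ⊗ₜ ν)) y =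
      r * Tannakian.dualBaseChange (R := R) (A := Alg G) R' (show WithConv (Module.Dual R (Alg G)) from ν) (algBaseChangeEquiv R' G y) := by
  letI := FiniteDual.bialgebra R' (R' ⊗[R] Alg G)
  have h := congrArg (fun F : WithConv (Module.Dual R' (R' ⊗[R] Alg G)) => WithConv.ofConv F (algBaseChangeEquiv R' G y))
    (dualAlgBaseChangeEquiv_tensorDualAlgEquiv_tmul R' G r ν)
  simp only [dualAlgBaseChangeEquiv_apply_apply, AlgEquiv.symm_apply_apply, WithConv.ofConv_smul, LinearMap.smul_apply, smul_eq_mul] at h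
  exact h

end Psi

section PsiNatural

variable {H G : SchemeOver R}
  [GrpObj H] [IsCommMonObj H] [IsAffine H.left] [Module.Free R (Alg H)] [Module.Finite R (Alg H)]
  [IsAffine ((Over.pullback (Spec.map (CommRingCat.ofHom (algebraMap R R')))).obj H).left]
  [IsCommMonObj ((Over.pullback (Spec.map (CommRingCat.ofHom (algebraMap R R')))).obj H)]
  [Module.Free R' (Alg ((Over.pullback (Spec.map (CommRingCat.ofHom (algebraMap R R')))).obj H))]
  [Module.Finite R' (Alg ((Over.pullback (Spec.map (CommRingCat.ofHom (algebraMap R R')))).obj H))]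
  [GrpObj G] [IsCommMonObj G] [IsAffine G.left] [Module.Free R (Alg G)] [Module.Finite R (Alg G)]
  [IsAffine ((Over.pullback (Spec.map (CommRingCat.ofHom (algebraMap R R')))).obj G).left]
  [IsCommMonObj ((Over.pullback (Spec.map (CommRingCat.ofHom (algebraMap R R')))).obj G)]
  [Module.Free R' (Alg ((Over.pullback (Spec.map (CommRingCat.ofHom (algebraMap R R')))).obj G))]
  [Module.Finite R' (Alg ((Over.pullback (Spec.map (CommRingCat.ofHom (algebraMap R R')))).obj G))]
  (j : H ⟶ G) [IsMonHom j]

omit [Module.Free R (Alg H)] [Module.Finite R (Alg H)]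
  [IsAffine ((Over.pullback (Spec.map (CommRingCat.ofHom (algebraMap R R')))).obj H).left]
  [IsCommMonObj ((Over.pullback (Spec.map (CommRingCat.ofHom (algebraMap R R')))).obj H)]
  [Module.Free R' (Alg ((Over.pullback (Spec.map (CommRingCat.ofHom (algebraMap R R')))).obj H))]
  [Module.Finite R' (Alg ((Over.pullback (Spec.map (CommRingCat.ofHom (algebraMap R R')))).obj H))]
  [Module.Free R (Alg G)] [Module.Finite R (Alg G)]
  [IsAffine ((Over.pullback (Spec.map (CommRingCat.ofHom (algebraMap R R')))).obj G).left]
  [IsCommMonObj ((Over.pullback (Spec.map (CommRingCat.ofHom (algebraMap R R')))).obj G)]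
  [Module.Free R' (Alg ((Over.pullback (Spec.map (CommRingCat.ofHom (algebraMap R R')))).obj G))]
  [Module.Finite R' (Alg ((Over.pullback (Spec.map (CommRingCat.ofHom (algebraMap R R')))).obj G))] in
/-- **Base change of linear forms is natural**: `((Γ(j))^* ν)_{R′} (z) = ν_{R′} ((R′ ⊗ Γ(j)) z)`. [cite: Tate1997FiniteFlatGroupSchemes, §(3.8) p. 145] -/
theorem dualBaseChange_transpose_apply (ν : DualAlg H) (z : R' ⊗[R] Alg G) :
    Tannakian.dualBaseChange (R := R) (A := Alg G) R' (show WithConv (Module.Dual R (Alg G)) from DualAlg.transpose j ν) z =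
      Tannakian.dualBaseChange (R := R) (A := Alg H) R' (show WithConv (Module.Dual R (Alg H)) from ν)
        (Algebra.TensorProduct.map (AlgHom.id R' R') (Alg.comap j) z) := by
  induction z using TensorProduct.induction_on with
  | zero => simp
  | tmul s a =>
    rw [Algebra.TensorProduct.map_tmul, Tannakian.dualBaseChange_apply_tmul, Tannakian.dualBaseChange_apply_tmul]
    exact congrArg (· • s) (DualAlg.transpose_apply_apply j ν a)
  | add x y hx hy => rw [map_add, map_add, map_add, hx, hy]

/-- Naturality of `Ψ` on pure tensors. [cite: Tate1997FiniteFlatGroupSchemes, §(3.8) p. 145] -/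
theorem transpose_pullback_map_tensorDualAlgEquiv_tmul (r : R') (ν : DualAlg H) :
    DualAlg.transpose ((Over.pullback (Spec.map (CommRingCat.ofHom (algebraMap R R')))).map j) (tensorDualAlgEquiv R' H (r ⊗ₜ ν)) =
      tensorDualAlgEquiv R' G (r ⊗ₜ DualAlg.transpose j ν) := by
  apply WithConv.ofConv_injective
  apply LinearMap.ext
  intro y
  rw [DualAlg.transpose_apply_apply, tensorDualAlgEquiv_tmul_apply, tensorDualAlgEquiv_tmul_apply, dualBaseChange_transpose_apply,
    algBaseChangeEquiv_comap_pullback_map]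

set_option synthInstance.maxHeartbeats 100000 in
set_option maxHeartbeats 400000 in
-- `map_add` for maps between the `DualAlg`s of the transported group objects `X_{R′}` re-derives their (pullback-monoidal) group structure (> 20k);
-- the declaration elaborates at ≈ 180k–200k heartbeats (young-heartbeat cliff N7, director s983): budget 400k as for the §3 declarations below (ED. 2)
/-- **NATURALITY OF `Ψ`: `(Γ(j_{R′}))^* (Ψ_H x) = Ψ_G ((R′ ⊗ (Γ(j))^*) x)`** — both sides evaluate `x = r ⊗ ν` at `y ∈ Γ(G_{R′})` to
`r · ν_{R′}((R′ ⊗ Γ(j))(e_G y))` (§1 formula, `dualBaseChange_transpose_apply`, ★ `algBaseChangeEquiv_comap_pullback_map`).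
[cite: Tate1997FiniteFlatGroupSchemes, §(3.8) p. 145] -/
theorem transpose_pullback_map_tensorDualAlgEquiv (x : R' ⊗[R] DualAlg H) :
    DualAlg.transpose ((Over.pullback (Spec.map (CommRingCat.ofHom (algebraMap R R')))).map j) (tensorDualAlgEquiv R' H x) =
      tensorDualAlgEquiv R' G (Algebra.TensorProduct.map (AlgHom.id R' R') (DualAlg.transpose j) x) := by
  induction x using TensorProduct.induction_on with
  | zero =>
    rw [show (0 : R' ⊗[R] DualAlg H) = (0 : R') ⊗ₜ[R] (0 : DualAlg H) from (TensorProduct.zero_tmul R' (0 : DualAlg H)).symm,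
      Algebra.TensorProduct.map_tmul, transpose_pullback_map_tensorDualAlgEquiv_tmul]
    rfl
  | tmul r ν => rw [Algebra.TensorProduct.map_tmul, transpose_pullback_map_tensorDualAlgEquiv_tmul]; rfl
  | add x y hx hy => rw [map_add, map_add, map_add, map_add, hx, hy]

end PsiNatural

/-! ## §2 `Φ_G : Γ((G^D)_{R′}) ≃ₐc Γ(G_{R′})^*` and the pinned isomorphism `φ_G : (G^D)_{R′} ≅ (G_{R′})^D` -/

section Iso

variable (G : SchemeOver R) [GrpObj G] [IsCommMonObj G] [IsAffine G.left] [Module.Free R (Alg G)] [Module.Finite R (Alg G)]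
  [IsAffine ((Over.pullback (Spec.map (CommRingCat.ofHom (algebraMap R R')))).obj G).left]
  [IsCommMonObj ((Over.pullback (Spec.map (CommRingCat.ofHom (algebraMap R R')))).obj G)]
  [Module.Free R' (Alg ((Over.pullback (Spec.map (CommRingCat.ofHom (algebraMap R R')))).obj G))]
  [Module.Finite R' (Alg ((Over.pullback (Spec.map (CommRingCat.ofHom (algebraMap R R')))).obj G))]
  [IsAffine ((Over.pullback (Spec.map (CommRingCat.ofHom (algebraMap R R')))).obj (cartierDual G)).left]

/-- **`Φ_G : Γ((G^D)_{R′}) ≃ₐc[R′] Γ(G_{R′})^*`** — `Γ((G^D)_{R′}) ≃ R′ ⊗ Γ(G^D) ≃ R′ ⊗ Γ(G)^* ≃ Γ(G_{R′})^*` (★ `algBaseChangeBialgEquiv`, ★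
`tensorAlgCartierDualBialgEquiv`, §1 `tensorDualAlgEquiv`). [cite: Tate1997FiniteFlatGroupSchemes, §(3.8) p. 145] -/
def algCartierDualBaseChangeEquiv :
    Alg ((Over.pullback (Spec.map (CommRingCat.ofHom (algebraMap R R')))).obj (cartierDual G)) ≃ₐc[R']
      DualAlg ((Over.pullback (Spec.map (CommRingCat.ofHom (algebraMap R R')))).obj G) :=
  (algBaseChangeBialgEquiv R' (cartierDual G)).trans ((tensorAlgCartierDualBialgEquiv R' G).trans (tensorDualAlgEquiv R' G))

/-- Unfolding `Φ_G`. [cite: Tate1997FiniteFlatGroupSchemes, §(3.8) p. 145] -/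
theorem algCartierDualBaseChangeEquiv_apply (y : Alg ((Over.pullback (Spec.map (CommRingCat.ofHom (algebraMap R R')))).obj (cartierDual G))) :
    algCartierDualBaseChangeEquiv R' G y =
      tensorDualAlgEquiv R' G (tensorAlgCartierDualBialgEquiv R' G (algBaseChangeEquiv R' (cartierDual G) y)) := rfl

set_option maxHeartbeats 400000 in
-- as in ★ `CartierDualBaseChange`: unifying the transported group object of `(G^D)_{R′}` with the displayed target costs ≈ 250k heartbeats
/-- **THE PINNED ISOMORPHISM `φ_G : (G^D)_{R′} ≅ (G_{R′})^D`**: `(G^D)_{R′} ≅ Spec Γ((G^D)_{R′})` (★ `isoSpecOver`) followed by `Spec Φ_G⁻¹`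
(★ `specOverIsoOfBialgEquiv`) — a definite witness of ★ `exists_iso_cartierDual_baseChange`. [cite: Tate1997FiniteFlatGroupSchemes, §(3.8) p. 145] -/
def cartierDualBaseChangeIso :
    (Over.pullback (Spec.map (CommRingCat.ofHom (algebraMap R R')))).obj (cartierDual G) ≅
      cartierDual ((Over.pullback (Spec.map (CommRingCat.ofHom (algebraMap R R')))).obj G) :=
  isoSpecOver ((Over.pullback (Spec.map (CommRingCat.ofHom (algebraMap R R')))).obj (cartierDual G)) ≪≫
    (specOverIsoOfBialgEquiv (algCartierDualBaseChangeEquiv R' G).symm :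
      specOver R' (Alg ((Over.pullback (Spec.map (CommRingCat.ofHom (algebraMap R R')))).obj (cartierDual G))) ≅
        cartierDual ((Over.pullback (Spec.map (CommRingCat.ofHom (algebraMap R R')))).obj G))

set_option maxHeartbeats 400000 in
-- same unification as above
/-- **`φ_G` is an isomorphism of GROUP schemes** (★ `isMonHom_isoSpecOver_hom`, ★ `isMonHom_specOverIsoOfBialgEquiv_hom`).
[cite: Tate1997FiniteFlatGroupSchemes, §(3.8) p. 145] -/
theorem isMonHom_cartierDualBaseChangeIso_hom : IsMonHom (cartierDualBaseChangeIso R' G).hom := by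
  let σ : specOver R' (Alg ((Over.pullback (Spec.map (CommRingCat.ofHom (algebraMap R R')))).obj (cartierDual G))) ≅
      cartierDual ((Over.pullback (Spec.map (CommRingCat.ofHom (algebraMap R R')))).obj G) :=
    specOverIsoOfBialgEquiv (algCartierDualBaseChangeEquiv R' G).symm
  letI : GrpObj (specOver R' (Alg ((Over.pullback (Spec.map (CommRingCat.ofHom (algebraMap R R')))).obj (cartierDual G)))) :=
    grpObjOfHopfAlgebra R' _
  haveI h1 : IsMonHom (isoSpecOver ((Over.pullback (Spec.map (CommRingCat.ofHom (algebraMap R R')))).obj (cartierDual G))).hom :=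
    isMonHom_isoSpecOver_hom _
  haveI h2 : IsMonHom σ.hom := isMonHom_specOverIsoOfBialgEquiv_hom (algCartierDualBaseChangeEquiv R' G).symm
  change IsMonHom ((isoSpecOver _).hom ≫ σ.hom)
  infer_instance

set_option maxHeartbeats 400000 in
-- same unification as above
/-- **The coordinates of `φ_G` are `Φ_G⁻¹`**: `coord φ_G.hom = Φ_G⁻¹ : Γ(G_{R′})^* → Γ((G^D)_{R′})` (★ `coord_specOverMapOfAlgHom`, ★ `coord_isoSpecOver_hom`).
[cite: Tate1997FiniteFlatGroupSchemes, §(3.8) p. 145] -/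
theorem coord_cartierDualBaseChangeIso_hom_apply (b : DualAlg ((Over.pullback (Spec.map (CommRingCat.ofHom (algebraMap R R')))).obj G)) :
    coord (cartierDualBaseChangeIso R' G).hom b = (algCartierDualBaseChangeEquiv R' G).symm b := by
  change coord ((isoSpecOver ((Over.pullback (Spec.map (CommRingCat.ofHom (algebraMap R R')))).obj (cartierDual G))).hom ≫
    (specOverIsoOfBialgEquiv (algCartierDualBaseChangeEquiv R' G).symm).hom) b = _
  rw [specOverIsoOfBialgEquiv_hom, coord_comp, coord_specOverMapOfAlgHom, ← AlgHom.comp_assoc]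
  change ((coord (isoSpecOver ((Over.pullback (Spec.map (CommRingCat.ofHom (algebraMap R R')))).obj (cartierDual G))).hom).comp _) b = _
  rw [coord_isoSpecOver_hom, AlgHom.id_comp]
  rfl

end Iso

/-! ## §3 HEAD: `φ` is natural in `G` -/

section Natural

variable {H G : SchemeOver R}
  [GrpObj H] [IsCommMonObj H] [IsAffine H.left] [Module.Free R (Alg H)] [Module.Finite R (Alg H)]
  [IsAffine ((Over.pullback (Spec.map (CommRingCat.ofHom (algebraMap R R')))).obj H).left]
  [IsCommMonObj ((Over.pullback (Spec.map (CommRingCat.ofHom (algebraMap R R')))).obj H)]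
  [Module.Free R' (Alg ((Over.pullback (Spec.map (CommRingCat.ofHom (algebraMap R R')))).obj H))]
  [Module.Finite R' (Alg ((Over.pullback (Spec.map (CommRingCat.ofHom (algebraMap R R')))).obj H))]
  [IsAffine ((Over.pullback (Spec.map (CommRingCat.ofHom (algebraMap R R')))).obj (cartierDual H)).left]
  [GrpObj G] [IsCommMonObj G] [IsAffine G.left] [Module.Free R (Alg G)] [Module.Finite R (Alg G)]
  [IsAffine ((Over.pullback (Spec.map (CommRingCat.ofHom (algebraMap R R')))).obj G).left]
  [IsCommMonObj ((Over.pullback (Spec.map (CommRingCat.ofHom (algebraMap R R')))).obj G)]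
  [Module.Free R' (Alg ((Over.pullback (Spec.map (CommRingCat.ofHom (algebraMap R R')))).obj G))]
  [Module.Finite R' (Alg ((Over.pullback (Spec.map (CommRingCat.ofHom (algebraMap R R')))).obj G))]
  [IsAffine ((Over.pullback (Spec.map (CommRingCat.ofHom (algebraMap R R')))).obj (cartierDual G)).left]
  (j : H ⟶ G) [IsMonHom j]

omit [IsAffine ((Over.pullback (Spec.map (CommRingCat.ofHom (algebraMap R R')))).obj H).left]
  [IsCommMonObj ((Over.pullback (Spec.map (CommRingCat.ofHom (algebraMap R R')))).obj H)]
  [Module.Free R' (Alg ((Over.pullback (Spec.map (CommRingCat.ofHom (algebraMap R R')))).obj H))]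
  [Module.Finite R' (Alg ((Over.pullback (Spec.map (CommRingCat.ofHom (algebraMap R R')))).obj H))]
  [IsAffine ((Over.pullback (Spec.map (CommRingCat.ofHom (algebraMap R R')))).obj (cartierDual H)).left]
  [IsAffine ((Over.pullback (Spec.map (CommRingCat.ofHom (algebraMap R R')))).obj G).left]
  [IsCommMonObj ((Over.pullback (Spec.map (CommRingCat.ofHom (algebraMap R R')))).obj G)]
  [Module.Free R' (Alg ((Over.pullback (Spec.map (CommRingCat.ofHom (algebraMap R R')))).obj G))]
  [Module.Finite R' (Alg ((Over.pullback (Spec.map (CommRingCat.ofHom (algebraMap R R')))).obj G))]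
  [IsAffine ((Over.pullback (Spec.map (CommRingCat.ofHom (algebraMap R R')))).obj (cartierDual G)).left] in
/-- `(R′ ⊗ (Γ(j))^*) ∘ (R′ ⊗ e_H) = (R′ ⊗ e_G) ∘ (R′ ⊗ Γ(j^D))` (★ `algCartierDualEquiv_comp_comap_cartierDualMap`, tensored with `R′`).
[cite: Tate1997FiniteFlatGroupSchemes, §(3.8) p. 145] -/
theorem map_transpose_tensorAlgCartierDualBialgEquiv (x : R' ⊗[R] Alg (cartierDual H)) :
    Algebra.TensorProduct.map (AlgHom.id R' R') (DualAlg.transpose j) (tensorAlgCartierDualBialgEquiv R' H x) =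
      tensorAlgCartierDualBialgEquiv R' G (Algebra.TensorProduct.map (AlgHom.id R' R') (Alg.comap (cartierDualMap j)) x) := by
  induction x using TensorProduct.induction_on with
  | zero => rw [map_zero, map_zero, map_zero, map_zero]
  | tmul r a =>
    rw [tensorAlgCartierDualBialgEquiv_tmul, Algebra.TensorProduct.map_tmul, Algebra.TensorProduct.map_tmul, tensorAlgCartierDualBialgEquiv_tmul,
      AlgHom.id_apply, algCartierDualBialgEquiv_apply, algCartierDualBialgEquiv_apply]
    have h := AlgHom.congr_fun (algCartierDualEquiv_comp_comap_cartierDualMap j) a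
    change algCartierDualEquiv G (Alg.comap (cartierDualMap j) a) = DualAlg.transpose j (algCartierDualEquiv H a) at h
    rw [h]
  | add x y hx hy => rw [map_add, map_add, map_add, map_add, hx, hy]

set_option synthInstance.maxHeartbeats 100000 in
set_option maxHeartbeats 400000 in
-- the transported group objects of `H_{R′}`, `G_{R′}`, `(H^D)_{R′}`, `(G^D)_{R′}` (see ★ `CartierDualBaseChange`)
/-- **NATURALITY OF `Φ`: `(Γ(j_{R′}))^* (Φ_H y) = Φ_G (Γ((j^D)_{R′}) y)`** (§1 naturality of `Ψ`, `map_transpose_tensorAlgCartierDualBialgEquiv`, ★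
`algBaseChangeEquiv_symm_map_comap`). [cite: Tate1997FiniteFlatGroupSchemes, §(3.8) p. 145] -/
theorem transpose_pullback_map_algCartierDualBaseChangeEquiv
    (y : Alg ((Over.pullback (Spec.map (CommRingCat.ofHom (algebraMap R R')))).obj (cartierDual H))) :
    DualAlg.transpose ((Over.pullback (Spec.map (CommRingCat.ofHom (algebraMap R R')))).map j) (algCartierDualBaseChangeEquiv R' H y) =
      algCartierDualBaseChangeEquiv R' G
        (Alg.comap ((Over.pullback (Spec.map (CommRingCat.ofHom (algebraMap R R')))).map (cartierDualMap j)) y) := by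
  obtain ⟨x, rfl⟩ := (algBaseChangeEquiv R' (cartierDual H)).symm.surjective y
  rw [← algBaseChangeEquiv_symm_map_comap, algCartierDualBaseChangeEquiv_apply, algCartierDualBaseChangeEquiv_apply, AlgEquiv.apply_symm_apply,
    AlgEquiv.apply_symm_apply, transpose_pullback_map_tensorDualAlgEquiv, map_transpose_tensorAlgCartierDualBialgEquiv]

set_option synthInstance.maxHeartbeats 100000 in
set_option maxHeartbeats 400000 in
-- the transported group objects of `H_{R′}`, `G_{R′}`, `(H^D)_{R′}`, `(G^D)_{R′}` (see ★ `CartierDualBaseChange`)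
/-- **HEAD — THE BASE-CHANGE ISOMORPHISM OF THE CARTIER DUAL IS NATURAL IN `G`: `(j^D)_{R′} ≫ φ_H = φ_G ≫ (j_{R′})^D`** for a homomorphism
`j : H ⟶ G` (its base change `j_{R′} := (Over.pullback _).map j` is a homomorphism of the transported group objects, Mathlib
`Functor.map.instIsMonHom`).  Read on coordinates (★ `coord_injective`): `Γ((j^D)_{R′}) ∘ Φ_H⁻¹ = Φ_G⁻¹ ∘ (Γ(j_{R′}))^*`, i.e.
`transpose_pullback_map_algCartierDualBaseChangeEquiv`. [cite: Tate1997FiniteFlatGroupSchemes, §(3.8) p. 145] -/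
theorem pullback_map_cartierDualMap_comp_cartierDualBaseChangeIso_hom :
    (Over.pullback (Spec.map (CommRingCat.ofHom (algebraMap R R')))).map (cartierDualMap j) ≫ (cartierDualBaseChangeIso R' H).hom =
      (cartierDualBaseChangeIso R' G).hom ≫
        cartierDualMap ((Over.pullback (Spec.map (CommRingCat.ofHom (algebraMap R R')))).map j) := by
  apply coord_injective
  apply AlgHom.ext
  intro b
  rw [coord_comp, coord_comp_cartierDualMap, AlgHom.comp_apply, AlgHom.comp_apply, coord_cartierDualBaseChangeIso_hom_apply,
    coord_cartierDualBaseChangeIso_hom_apply]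
  have key := transpose_pullback_map_algCartierDualBaseChangeEquiv R' j ((algCartierDualBaseChangeEquiv R' H).symm b)
  rw [BialgEquiv.apply_symm_apply] at key
  rw [key, BialgEquiv.symm_apply_apply]

end Natural

end AffineGroupScheme

end Literature.AlgebraicGeometry.GroupSchemes

end
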